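import Mathlib
import Summits.ValiantsHypothesis.ValiantsHypothesis.Theses.ValuativeGCT
import Literature.Computability.Complexity.OccurrenceObstructionsBIP

/-!
# `NoValuativeFlip` (stmt-ValiantsHypothesis-12629) holds outside the Kadish–Landsberg cone

Route `ValuativeGCT`, support item `NoValuativeFlip` (kill statement: beyond some polynomial
padding, `mult_{λ*} ℂ[Δ(X₀₀^(m-n) per_n)] ≤ dim T_U(λ)` for every truncation `(U, r)` and every
`(δ, λ)`). Unconditional partial result: the inequality holds — for EVERY `n ≤ m`, every centre
`(U, r)` and every degree `δ` — at all shapes `λ ⊢ m δ` outside the Kadish–Landsberg cone, i.e.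
with first part `λ₁ < δ (m - n)` or with more than `n² + 1` parts, because there the left side
vanishes: by Kadish–Landsberg 2014 (BIP 2019 Thm. 4.9(2), PROVED in the tree as
`Literature.Computability.Complexity.kadish_landsberg_padding_holds`) an irreducible `λ*` occurring
in `ℂ[Δ(X₀₀^(m-n) per_n)]_δ` has `λ₁ ≥ δ (m - n)`, and by BIP 2019 Thm. 4.9(1) (PROVED:
`apply_eq_zero_of_hasHighestWeight_orbitCoordRep_of_vars_subset` with
`vars_paddedPerFormLex_subset`) it has at most `n² + 1` parts (the padded permanent involves only
`n² + 1` variables). So every witness against `NoValuativeFlip` — equivalently (file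
`ValuativeGCTNoValuativeFlipReductions`) every valuative flip — lives on Kadish–Landsberg shapes
`δ (m - n) ≤ λ₁`, `ℓ(λ) ≤ n² + 1` (the route's `GCTUsefulModules` barrier, here as a theorem about
the item's own inequality).

Sources: H. Kadish, J. M. Landsberg, *Padded polynomials, their cousins, and geometric complexity
theory*, Comm. Algebra 42 (2014), main theorem; P. Bürgisser, C. Ikenmeyer, G. Panova, J. AMS 32
(2019), Thm. 4.9; BLMW 2011 (5.2.2).
-/

-- `Summit.ValiantsHypothesis.ValiantsHypothesis.…` repeats a component by the D-0017 layout
-- (single-conjunct summit), which the `dupNamespace` linter flags; the name is mandated.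
set_option linter.dupNamespace false

namespace Summit.ValiantsHypothesis.ValiantsHypothesis.Theorems.NoValuativeFlip

open Literature.NumberTheory.DiophantineGeometry Literature.Computability.AlgebraicComplexity
open Summit.ValiantsHypothesis.ValiantsHypothesis.Theses.ValuativeGCT

/-- **Kadish–Landsberg constraints in the route's typing.** If the dual weight
`(Weight.dualOfPartition (m*m) λ).toMatIdx` of a partition `λ ⊢ m δ` with at most `m²` parts
occurs in `ℂ[Δ(X₀₀^(m-n) per_n)]` (`n ≤ m`), then `δ (m - n) ≤ λ₁` (`λ₁ = λ.parts.sup`,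
Kadish–Landsberg 2014 / BIP 2019 Thm. 4.9(2), tree: `kadish_landsberg_padding_holds`, applied to
`λ` re-typed as a partition of `δ m` with the same parts) and `ℓ(λ) ≤ n² + 1` (BIP 2019
Thm. 4.9(1): the form involves only the `n² + 1` variables `{X₀₀} ∪ block`; tree:
`apply_eq_zero_of_hasHighestWeight_orbitCoordRep_of_vars_subset`,
`vars_paddedPerFormLex_subset`, `card_parts_le_of_dualOfPartition_apply_eq_zero`). -/
theorem kadishLandsberg_of_hasHighestWeight_paddedPerOrbitRep {n m : ℕ} [NeZero m] (hnm : n ≤ m)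
    {δ : ℕ} (lam : Nat.Partition (m * δ)) (hcard : lam.parts.card ≤ m * m)
    (h : HasHighestWeight (paddedPerOrbitRep ℂ n m) (Weight.dualOfPartition (m * m) lam).toMatIdx) :
    δ * (m - n) ≤ lam.parts.sup ∧ lam.parts.card ≤ n ^ 2 + 1 := by
  classical
  refine ⟨?_, ?_⟩
  · -- Kadish–Landsberg, for `λ` re-typed as a partition of `δ * m` (same parts)
    exact Literature.Computability.Complexity.kadish_landsberg_padding_holds n m δ hnm
      ⟨lam.parts, lam.parts_pos, by rw [lam.parts_sum, mul_comm]⟩ hcard h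
  · -- BIP Thm. 4.9(1): the weight vanishes beyond the first `n² + 1` (lexicographic) indices
    set e := matIdxEquiv m with he
    change HasHighestWeight (orbitCoordRep (paddedPerFormLex ℂ n m) m) _ at h
    apply card_parts_le_of_dualOfPartition_apply_eq_zero lam hcard
    intro i hi
    have hA := Literature.Computability.Complexity.card_insert_image_blockIdx_le n m hnm
    have h0 := apply_eq_zero_of_hasHighestWeight_orbitCoordRep_of_vars_subset e _ _
      (Literature.Computability.Complexity.vars_paddedPerFormLex_subset (k := ℂ) n m) h i (by omega)
    simpa only [Weight.toMatIdx, he, OrderIso.symm_apply_apply] using h0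

/-- **No occurrence outside the Kadish–Landsberg cone**: for `n ≤ m` and `λ ⊢ m δ` with at most
`m²` parts, if `λ₁ < δ (m - n)` or `ℓ(λ) > n² + 1` then the multiplicity of `λ*` in
`ℂ[Δ(X₀₀^(m-n) per_n)]` is `0` (the highest-weight space is `⊥` by
`kadishLandsberg_of_hasHighestWeight_paddedPerOrbitRep`). Kadish–Landsberg 2014; BIP 2019
Thm. 4.9. -/
theorem orbitMultiplicity_paddedPer_eq_zero_of_not_kadishLandsberg {n m : ℕ} [NeZero m]
    (hnm : n ≤ m) {δ : ℕ} (lam : Nat.Partition (m * δ)) (hcard : lam.parts.card ≤ m * m)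
    (hKL : lam.parts.sup < δ * (m - n) ∨ n ^ 2 + 1 < lam.parts.card) :
    orbitMultiplicity ℂ (paddedPerFormLex ℂ n m) m (Weight.dualOfPartition (m * m) lam).toMatIdx
      = 0 := by
  by_cases hw : HasHighestWeight (paddedPerOrbitRep ℂ n m) (Weight.dualOfPartition (m * m) lam).toMatIdx
  · obtain ⟨h1, h2⟩ := kadishLandsberg_of_hasHighestWeight_paddedPerOrbitRep hnm lam hcard hw
    exfalso
    rcases hKL with hKL | hKL <;> omega
  · have hbot : highestWeightSpace (orbitCoordRep (paddedPerFormLex ℂ n m) m)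
        (Weight.dualOfPartition (m * m) lam).toMatIdx = ⊥ := not_not.mp hw
    rw [orbitMultiplicity, hwMultiplicity, hbot]
    exact finrank_bot ℂ _

/-- **`NoValuativeFlip` outside the Kadish–Landsberg cone (unconditional, all `n ≤ m`).** The
inequality of the kill statement `NoValuativeFlip` (stmt-ValiantsHypothesis-12629) — with its
truncation `T_U(λ)` verbatim — holds for every `n ≤ m`, every centre `(U, r)` (no rank hypothesis
is needed), every degree `δ` and every `λ ⊢ m δ` with at most `m²` parts whose first part is
`< δ (m - n)` or which has more than `n² + 1` parts: the left side is `0`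
(`orbitMultiplicity_paddedPer_eq_zero_of_not_kadishLandsberg`). Hence any counterexample to
`NoValuativeFlip` (equivalently any valuative flip of the crux `ValuativeFlip`) lives on
Kadish–Landsberg shapes `δ (m - n) ≤ λ₁`, `ℓ(λ) ≤ n² + 1`. Kadish–Landsberg 2014; BIP 2019
Thm. 4.9; the route's `GCTUsefulModules` barrier. -/
theorem noValuativeFlip_body_of_not_kadishLandsberg {n : ℕ} (m : ℕ) [NeZero m] (hnm : n ≤ m)
    (U : Submodule ℂ (MatIdx m → ℂ)) (r : ℕ) (δ : ℕ) (lam : Nat.Partition (m * δ))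
    (hcard : lam.parts.card ≤ m * m)
    (hKL : lam.parts.sup < δ * (m - n) ∨ n ^ 2 + 1 < lam.parts.card) :
    let χ : Literature.NumberTheory.DiophantineGeometry.Weight (Literature.NumberTheory.DiophantineGeometry.MatIdx m) := (Literature.NumberTheory.DiophantineGeometry.Weight.dualOfPartition (m * m) lam).toMatIdx; let T : Submodule ℂ (MvPolynomial (Literature.NumberTheory.DiophantineGeometry.MatIdx m × Literature.NumberTheory.DiophantineGeometry.MatIdx m) ℂ) := MvPolynomial.homogeneousSubmodule (Literature.NumberTheory.DiophantineGeometry.MatIdx m × Literature.NumberTheory.DiophantineGeometry.MatIdx m) ℂ (m * δ) ⊓ ((MvPolynomial.vanishingIdeal ℂ {p : Literature.NumberTheory.DiophantineGeometry.MatIdx m × Literature.NumberTheory.DiophantineGeometry.MatIdx m → ℂ | ∀ j : Literature.NumberTheory.DiophantineGeometry.MatIdx m, (fun i => p (j, i)) ∈ U}) ^ (δ * (m - r))).restrictScalars ℂ ⊓ (⨅ (M : Matrix (Literature.NumberTheory.DiophantineGeometry.MatIdx m) (Literature.NumberTheory.DiophantineGeometry.MatIdx m) ℂ) (_ : Literature.Computability.AlgebraicComplexity.linSubst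 (Literature.NumberTheory.DiophantineGeometry.MatIdx m) ℂ M (Literature.NumberTheory.DiophantineGeometry.detFormLex ℂ m) = Literature.NumberTheory.DiophantineGeometry.detFormLex ℂ m), LinearMap.ker ((MvPolynomial.aeval (R := ℂ) fun p : Literature.NumberTheory.DiophantineGeometry.MatIdx m × Literature.NumberTheory.DiophantineGeometry.MatIdx m => ∑ l : Literature.NumberTheory.DiophantineGeometry.MatIdx m, M l p.2 • MvPolynomial.X (p.1, l)).toLinearMap - LinearMap.id (R := ℂ) (M := MvPolynomial (Literature.NumberTheory.DiophantineGeometry.MatIdx m × Literature.NumberTheory.DiophantineGeometry.MatIdx m) ℂ))) ⊓ (⨅ (g : Matrix.GeneralLinearGroup (Literature.NumberTheory.DiophantineGeometry.MatIdx m) ℂ) (_ : Literature.NumberTheory.DiophantineGeometry.IsUpperTriangular g), LinearMap.ker ((MvPolynomial.aeval (R := ℂ) fun p : Literature.NumberTheory.DiophantineGeometry.MatIdx m × Literature.NumberTheory.DiophantineGeometry.MatIdx m => ∑ l : Literature.NumberTheory.DiophantineGeometry.MatIdx m, ((g⁻¹ : Matrix.GeneralLinearGroup (Literature.NumberTheory.DiophantineGeometry.MatIdx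 m) ℂ) : Matrix (Literature.NumberTheory.DiophantineGeometry.MatIdx m) (Literature.NumberTheory.DiophantineGeometry.MatIdx m) ℂ) p.1 l • MvPolynomial.X (l, p.2)).toLinearMap - Literature.NumberTheory.DiophantineGeometry.weightChar χ g • LinearMap.id (R := ℂ) (M := MvPolynomial (Literature.NumberTheory.DiophantineGeometry.MatIdx m × Literature.NumberTheory.DiophantineGeometry.MatIdx m) ℂ))); Literature.NumberTheory.DiophantineGeometry.orbitMultiplicity ℂ (Literature.NumberTheory.DiophantineGeometry.paddedPerFormLex ℂ n m) m χ ≤ Module.finrank ℂ ↥T := by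
  intro χ T
  rw [orbitMultiplicity_paddedPer_eq_zero_of_not_kadishLandsberg hnm lam hcard hKL]
  exact Nat.zero_le _

end Summit.ValiantsHypothesis.ValiantsHypothesis.Theorems.NoValuativeFlip
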